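import Mathlib
import HarnessLib.Audit
import Summits.PneNP.PneNP.Theorems.PstarNorUnitExc

/-!
# The (U2) corner is a CONS-T unit: a doubly-read single chord closes a triangle (ROUND-24, memo §7 G4 / §9 O3; residue (c3))

FRONTIER range-avoidance ladder, rung F-N3, ROUND 24 (cell `pnp-ideate`, planner memo `r24/CORE-BOUND-NOTES.md` §7 G4 ("(U2) corner"), §9 O3,
§12 K15 ("the (U2)/O3 corner … cannot grow"); restricted-model proof complexity — nothing here bears on `P` versus `NP`).

`PstarChordBridgeCorner.corner_factorisation` reduced the (U2) corner of the regime theorem — chord set `N = {e₀}`, the two privates of `e₀` read in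
independent constant directions `r, r'` — to a NON-TRIVIAL FACTORISATION `Q_{D e₀} + γ + 1 = q_{r'} · q_r` of the fundamental AND-sum into the two
basis-changed constraints (`q_m = qDir I B m`), both non-constant and distinct.  This file finishes the corner:

* `dir_cases_of_factor` — for each factor `q_m` (`m ∈ {r, r'}`) the containment `Z(q_m) ⊆ {Q_{D e₀} = γ + 1}` is immediate from the
  factorisation, so `PstarForcing.forcing_cases` applies to `(q_m, Q_{D e₀})`: `Z(q_m) = ∅` contradicts non-constancy; (EQ) `Q = q_m + κ` forces
  `q_m = Q + γ + 1` (the other sign `q_m = Q + γ` gives `0 = 1` at any point with `Q = γ`); (EXC) is `PstarNorUnitExc.exc_unit_of_dir`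
  (prover-1) — (EQ) again or a CONS-T pair; (NOR) is `PstarNorUnitDir.nor_unit_of_dir` (prover-1) — a CONS-T pair.  So: `q_m = Q + γ + 1`, or
  `D e₀` is a CONS-T pair `{j₁, j₂}` (disjoint AND pairs, literals `σ ∈ j₁`, `τ ∈ j₂` realised together by a join / private-free pendant);
* `corner_unit` — both factors cannot equal `Q + γ + 1` (they are distinct), hence **in the (U2) corner `D e₀` is a CONS-T pair**;
* `card_eq_three_of_corner` — **the (U2) disjunct of `PstarNorUnitEQ1.regime_trichotomy` has `#J₀ = 3`**: with `J₀ = D e₀ + e₀` (the single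
  cycle) the core is a triangle — the memo's K15 size-3 corner `{triangle; w₁ = OR(p_e, p_{e'})}`.

With `PstarChordBridgeKill.killable_pair` (hK discharged) and prover-1's `exc_unit_of_dir` (EXC), the three guises of the elliptic residue (c) are
now all units; what the chain still ASSUMES is Assumption A (liftable co-forest), no CROSS pendant, privates unread (memo O1/O2).
-/

set_option linter.dupNamespace false -- `Summit.PneNP.PneNP.…`: summit = sub-problem name (D-0017 single-conjunct layout)

open Finset Module Literature.Computability.Complexity
open Summit.PneNP.PneNP.Theorems.PstarTyped (Typed)
open Summit.PneNP.PneNP.Theorems.PstarSALevel (varSet bdry BoundaryExpanding SimpleOverlap)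
open Summit.PneNP.PneNP.Theorems.PstarGapLinearised (andPair)
open Summit.PneNP.PneNP.Theorems.PstarCubeIdeals (IsAffineFn)
open Summit.PneNP.PneNP.Theorems.PstarForcing (forcing_cases exists_ne_of_rank_four)
open Summit.PneNP.PneNP.Theorems.PstarProductRank (qform polar)
open Summit.PneNP.PneNP.Theorems.PstarReadSumset (V2)
open Summit.PneNP.PneNP.Theorems.PstarChordSystem (ChordSystem)
open Summit.PneNP.PneNP.Theorems.PstarChordBridgeTools
open Summit.PneNP.PneNP.Theorems.PstarChordBridge
open Summit.PneNP.PneNP.Theorems.PstarChordBridgeForcing (freeMon gam sys_u_eq qform_add' rank_four_of_wf const_of_unread)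
open Summit.PneNP.PneNP.Theorems.PstarChordBridgeBasis (qDir polarDir)
open Summit.PneNP.PneNP.Theorems.PstarChordBridgeCorner (qDir_add corner_factorisation)
open Summit.PneNP.PneNP.Theorems.PstarNorUnitDir (nor_unit_of_dir)
open Summit.PneNP.PneNP.Theorems.PstarNorUnitExc (exc_unit_of_dir)

namespace Summit.PneNP.PneNP.Theorems.PstarChordBridgeCornerUnit

variable {n m : ℕ}

/-- **One factor of the corner factorisation.**  Well-formed bridge data (pure `(r,3/2)`-expanding, simple overlaps, `#(J₀ ∪ G₁ ∪ G₂) ≤ r`), a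
chord `e ∈ N ∖ (G₁ ∪ G₂)`, a direction `m` with `q_m` non-constant, and a factorisation `γ_e + Q_{D e}(x) = f(x) · q_m(x) + 1` (any cofactor
`f`).  Then `q_m = Q_{D e} + γ_e + 1`, or `D e` is a CONS-T pair: two outputs with disjoint AND pairs carrying literals `σ, τ` that some join
output or private-free pendant realises together. -/
theorem dir_cases_of_factor (I : LocalMap 4 n m) (hI : I.IsPure xorAndPred) (hS : SimpleOverlap I) {r : ℕ} (hB : BoundaryExpanding r I)
    {B : BridgeData n m} (hW : B.WF I) (hr : (B.J₀ ∪ B.G₁ ∪ B.G₂).card ≤ r) {e : Fin m} (he : e ∈ B.N) (heG : e ∉ B.G₁ ∪ B.G₂) (mv : V2)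
    (hnc : ¬ ∃ κ, ∀ x, qDir I B mv x = κ) {f : (Fin n → ZMod 2) → ZMod 2}
    (hF : ∀ x, gam B e + qform (B.D e) (fun j => I.vars j 2) (fun j => I.vars j 3) x = f x * qDir I B mv x + 1) :
    (∀ x, qDir I B mv x = qform (B.D e) (fun j => I.vars j 2) (fun j => I.vars j 3) x + gam B e + 1) ∨
    (∃ j₁ j₂ : Fin m, j₁ ≠ j₂ ∧ B.D e = {j₁, j₂} ∧ Disjoint (andPair I j₁) (andPair I j₂) ∧
      ∃ σ ∈ andPair I j₁, ∃ τ ∈ andPair I j₂, ∃ g ∈ B.T₁ ∪ freeMon I B.N B.G₁ ∪ (B.T₂ ∪ freeMon I B.N B.G₂),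
        σ ∈ andPair I g ∧ τ ∈ andPair I g) := by
  classical
  have hJr : B.J₀.card ≤ r := (card_le_card (subset_union_left.trans subset_union_left)).trans hr
  have hrank := rank_four_of_wf I hI hS hB hW hJr he
  -- the containment `Z(q_m) ⊆ {Q = γ + 1}`
  have hZ : ∀ x, qDir I B mv x = 0 → qform (B.D e) (fun j => I.vars j 2) (fun j => I.vars j 3) x = gam B e + 1 := by
    intro x hx
    have h := hF x
    rw [hx, mul_zero, zero_add] at h
    have e1 : ∀ g Q : ZMod 2, g + Q = 1 → Q = g + 1 := by decide
    exact e1 _ _ h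
  -- (EQ) with the wrong constant is impossible; with the right one it is the first alternative
  have hEQ : ∀ κ : ZMod 2, (∀ x, qform (B.D e) (fun j => I.vars j 2) (fun j => I.vars j 3) x = qDir I B mv x + κ) →
      ∀ x, qDir I B mv x = qform (B.D e) (fun j => I.vars j 2) (fun j => I.vars j 3) x + gam B e + 1 := by
    intro κ hκ
    by_cases hκγ : κ = gam B e + 1
    · intro x; rw [hκ x, hκγ]; ring_nf; generalize qDir I B mv x = t; revert t; generalize gam B e = g; revert g; decide
    · -- `κ = γ`: at a point with `Q = γ` the factorisation reads `0 = 1`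
      exfalso
      have hκ' : κ = gam B e := by
        have z : ∀ k g : ZMod 2, ¬ k = g + 1 → k = g := by decide
        exact z _ _ hκγ
      obtain ⟨x₀, hx₀⟩ : ∃ x₀, qform (B.D e) (fun j => I.vars j 2) (fun j => I.vars j 3) x₀ = gam B e := by
        by_cases hγ : gam B e = 0
        · refine ⟨0, ?_⟩
          rw [hγ]
          simp only [qform, Pi.zero_apply, mul_zero, sum_const_zero]
        · obtain ⟨v, hv⟩ := exists_ne_of_rank_four (qform_add' I (B.D e)) hrank
          have h0 : qform (B.D e) (fun j => I.vars j 2) (fun j => I.vars j 3) (0 : Fin n → ZMod 2) = 0 := by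
            simp only [qform, Pi.zero_apply, mul_zero, sum_const_zero]
          rw [h0] at hv
          refine ⟨v, ?_⟩
          revert hv hγ; generalize qform (B.D e) (fun j => I.vars j 2) (fun j => I.vars j 3) v = t; generalize gam B e = g
          revert t g; decide
      have h1 := hF x₀
      have h2 := hκ x₀
      rw [hx₀, hκ'] at h2
      -- `q_m(x₀) = 0`, so the factorisation gives `γ + γ = 1`
      have hq0 : qDir I B mv x₀ = 0 := by
        revert h2; generalize qDir I B mv x₀ = t; generalize gam B e = g; revert t g; decide
      rw [hx₀, hq0, mul_zero, zero_add] at h1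
      revert h1; generalize gam B e = g; revert g; decide
  rcases forcing_cases (qDir_add I B mv) (qform_add' I (B.D e)) hrank hZ with
      h1 | ⟨κ, hκ⟩ | ⟨ν₁, ν₂, hν₁, hν₂, κ, hκ⟩ | ⟨a, b, hab, hqf, m₁, m₂, hm₁, hm₂, hQ⟩
  · exact absurd ⟨1, h1⟩ hnc
  · exact Or.inl (hEQ κ hκ)
  · rcases exc_unit_of_dir I hI hS hB hW hr he heG mv hZ hν₁ hν₂ hκ with ⟨κ', hκ'⟩ | ⟨j₁, j₂, σ, τ, hne, hD, hdisj, hσ, hτ, -, g, hg, hσg, hτg⟩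
    · exact Or.inl (hEQ κ' hκ')
    · exact Or.inr ⟨j₁, j₂, hne, hD, hdisj, σ, hσ, τ, hτ, g, hg, hσg, hτg⟩
  · obtain ⟨j₁, j₂, σ, τ, hne, hD, hdisj, hσ, hτ, -, g, hg, hσg, hτg⟩ :=
      nor_unit_of_dir I hI hS hB hW hr he heG mv (β := qDir I B mv b + qDir I B mv 0) (α := qDir I B mv a + qDir I B mv 0) hqf hm₁ hm₂ hQ
    exact Or.inr ⟨j₁, j₂, hne, hD, hdisj, σ, hσ, τ, hτ, g, hg, hσg, hτg⟩

/-- **The (U2) corner is a CONS-T unit.**  Pure typed `(r,3/2)`-expanding instance with simple overlaps; well-formed liftable bridge data with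
`#(J₀ ∪ G₁ ∪ G₂) ≤ r`, pendants off the core, no pendant reading a private; the terminal system unsolvable, solvable after deleting any output of
`D e₀`; chord set `N = {e₀}` with the two (constant) read vectors of `e₀` non-zero and distinct.  Then `D e₀` is a CONS-T pair. -/
theorem corner_unit (I : LocalMap 4 n m) (hI : I.IsPure xorAndPred) (hT : Typed I) (hS : SimpleOverlap I) {r : ℕ}
    (hB : BoundaryExpanding r I) {B : BridgeData n m} (hW : B.WF I) (hr : (B.J₀ ∪ B.G₁ ∪ B.G₂).card ≤ r)
    (hG₁ : Disjoint B.G₁ B.J₀) (hG₂ : Disjoint B.G₂ B.J₀) (hL : Lift I B)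
    (hun : ∀ v ∈ privs I B.N, (∀ g ∈ B.G₁, I.vars g 2 ≠ v ∧ I.vars g 3 ≠ v) ∧ ∀ g ∈ B.G₂, I.vars g 2 ≠ v ∧ I.vars g 3 ≠ v)
    (hT3 : ¬ ∃ z, Solution I B B.J₀ z) {e₀ : Fin m} (hM0 : ∀ j ∈ B.D e₀, ∃ z, Solution I B (B.J₀.erase j) z) (hN : B.N = {e₀})
    (h1 : (sys I B).ρ e₀ 0 ≠ 0) (h2 : (sys I B).ρ' e₀ 0 ≠ 0) (h3 : (sys I B).ρ e₀ 0 ≠ (sys I B).ρ' e₀ 0) :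
    ∃ j₁ j₂ : Fin m, j₁ ≠ j₂ ∧ B.D e₀ = {j₁, j₂} ∧ Disjoint (andPair I j₁) (andPair I j₂) ∧
      ∃ σ ∈ andPair I j₁, ∃ τ ∈ andPair I j₂, ∃ g ∈ B.T₁ ∪ freeMon I B.N B.G₁ ∪ (B.T₂ ∪ freeMon I B.N B.G₂),
        σ ∈ andPair I g ∧ τ ∈ andPair I g := by
  classical
  have he₀ : e₀ ∈ B.N := by rw [hN]; exact mem_singleton_self _
  have he₀J : e₀ ∈ B.J₀ := hW.hN he₀
  have heG : e₀ ∉ B.G₁ ∪ B.G₂ := fun h => by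
    rcases mem_union.1 h with h | h
    · exact disjoint_left.1 hG₁ h he₀J
    · exact disjoint_left.1 hG₂ h he₀J
  have hJr : B.J₀.card ≤ r := (card_le_card (subset_union_left.trans subset_union_left)).trans hr
  have hconst := const_of_unread I B hun
  have hρ : ∀ x, (sys I B).ρ e₀ x = (sys I B).ρ e₀ 0 := fun x => (hconst e₀ x 0).1
  have hρ' : ∀ x, (sys I B).ρ' e₀ x = (sys I B).ρ' e₀ 0 := fun x => (hconst e₀ x 0).2
  have hp := hun _ (vars_mem_privs I he₀ (s := 2) (by decide))
  have hp' := hun _ (vars_mem_privs I he₀ (s := 3) (by decide))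
  have hG₁' : ∀ g ∈ B.G₁, I.vars g 2 ≠ I.vars e₀ 2 ∧ I.vars g 2 ≠ I.vars e₀ 3 ∧ I.vars g 3 ≠ I.vars e₀ 2 ∧ I.vars g 3 ≠ I.vars e₀ 3 :=
    fun g hg => ⟨(hp.1 g hg).1, (hp'.1 g hg).1, (hp.1 g hg).2, (hp'.1 g hg).2⟩
  have hG₂' : ∀ g ∈ B.G₂, I.vars g 2 ≠ I.vars e₀ 2 ∧ I.vars g 2 ≠ I.vars e₀ 3 ∧ I.vars g 3 ≠ I.vars e₀ 2 ∧ I.vars g 3 ≠ I.vars e₀ 3 :=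
    fun g hg => ⟨(hp.2 g hg).1, (hp'.2 g hg).1, (hp.2 g hg).2, (hp'.2 g hg).2⟩
  have hinf : (sys I B).Infeasible B.N := infeasible_of_not_solution I hI hT hW hL hT3
  obtain ⟨hfac, hncr, hncr', hne⟩ := corner_factorisation I hI hT hS hB hW hJr hG₁.symm hG₂.symm hN h1 h2 h3 hρ hρ' hG₁' hG₂' hinf hT3 hM0
  -- the factorisation, read for each factor
  have hFr : ∀ x, gam B e₀ + qform (B.D e₀) (fun j => I.vars j 2) (fun j => I.vars j 3) x =
      qDir I B ((sys I B).ρ' e₀ 0) x * qDir I B ((sys I B).ρ e₀ 0) x + 1 := fun x => by rw [← sys_u_eq]; exact hfac x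
  have hFr' : ∀ x, gam B e₀ + qform (B.D e₀) (fun j => I.vars j 2) (fun j => I.vars j 3) x =
      qDir I B ((sys I B).ρ e₀ 0) x * qDir I B ((sys I B).ρ' e₀ 0) x + 1 := fun x => by rw [mul_comm]; exact hFr x
  rcases dir_cases_of_factor I hI hS hB hW hr he₀ heG _ hncr hFr with hq | hunit
  · rcases dir_cases_of_factor I hI hS hB hW hr he₀ heG _ hncr' hFr' with hq' | hunit
    · exact absurd (fun x => (hq x).trans (hq' x).symm) hne
    · exact hunit
  · exact hunit

/-- **The (U2) disjunct of the regime trichotomy is a triangle.**  Under the hypotheses of `corner_unit` and with `J₀ = D e₀ + e₀` (the single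
cycle of `PstarNorUnitRegime.J₀_eq_of_single`), the core has exactly three outputs. -/
theorem card_eq_three_of_corner (I : LocalMap 4 n m) (hI : I.IsPure xorAndPred) (hT : Typed I) (hS : SimpleOverlap I) {r : ℕ}
    (hB : BoundaryExpanding r I) {B : BridgeData n m} (hW : B.WF I) (hr : (B.J₀ ∪ B.G₁ ∪ B.G₂).card ≤ r)
    (hG₁ : Disjoint B.G₁ B.J₀) (hG₂ : Disjoint B.G₂ B.J₀) (hL : Lift I B)
    (hun : ∀ v ∈ privs I B.N, (∀ g ∈ B.G₁, I.vars g 2 ≠ v ∧ I.vars g 3 ≠ v) ∧ ∀ g ∈ B.G₂, I.vars g 2 ≠ v ∧ I.vars g 3 ≠ v)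
    (hT3 : ¬ ∃ z, Solution I B B.J₀ z) (hM0 : ∀ f ∈ B.J₀, ∃ z, Solution I B (B.J₀.erase f) z) {e₀ : Fin m} (hN : B.N = {e₀})
    (hJ : B.J₀ = insert e₀ (B.D e₀))
    (h1 : (sys I B).ρ e₀ 0 ≠ 0) (h2 : (sys I B).ρ' e₀ 0 ≠ 0) (h3 : (sys I B).ρ e₀ 0 ≠ (sys I B).ρ' e₀ 0) : B.J₀.card = 3 := by
  classical
  have he₀ : e₀ ∈ B.N := by rw [hN]; exact mem_singleton_self _
  have heD : e₀ ∉ B.D e₀ := fun h => (mem_sdiff.1 (hW.hD e₀ he₀ h)).2 he₀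
  obtain ⟨j₁, j₂, hne, hD, -⟩ := corner_unit I hI hT hS hB hW hr hG₁ hG₂ hL hun hT3
    (fun j hj => hM0 j (mem_sdiff.1 (hW.hD e₀ he₀ hj)).1) hN h1 h2 h3
  rw [hJ, card_insert_of_notMem heD, hD, card_pair hne]

end Summit.PneNP.PneNP.Theorems.PstarChordBridgeCornerUnit
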